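import Summits.BirchSwinnertonDyer.Rank1Residual.X2.GreenbergVatsalReductionDatum
import Literature.NumberTheory.EllipticCurves.CyclotomicLineWeilPairingProofs
import Literature.NumberTheory.GaloisRepresentations.LocalKroneckerWeberInertiaProofs
import HarnessLib

/-!
# `C[p] ≅ μ_p` for Greenberg's datum at an odd good ordinary prime of `E/ℚ`, IN THE KERNEL: the
# inertia group MOVES every point of `C[p]` (the hypothesis `hgen` of the intrinsic Greenberg–Vatsal
# transfer) — from the Weil pairing and `χ_p(I_{ℚ_p}) = ℤ_p^×`

HONEST FRAMING (cell `b2b-bsdres`, run/shared/lean/b2b/bsd-rank1-residual/, verbatim in every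
file): the goal of the cell is to DELETE the COMBINATION-SHAPED residual classes of the
Birch–Swinnerton-Dyer formula for ALL analytic-rank `≤ 1` elliptic curves over `ℚ` — "full BSD
formula for every rank `≤ 1` curve in class `C`" assembled STRICTLY from published theorems — so
that the rank-`≤ 1` remainder becomes exactly the CONSTRUCTION-SHAPED classes, which are TYPED
(missing-input `Prop`s), NOT attempted. This is not "finishing BSD". Sub-cell
`b2b-bsdres-eisenstein-p2` (CLASS-OWNERS row "X2"), gen 9: research route; NO CLAIM BEYOND STATED
CLASSES; nothing here changes a label. Theorems only (no `def`, no named fact, nothing asserted).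

GREENBERG–VATSAL p. 26 (arXiv:math/9906215): "By the Weil pairing, one sees that the inertia group
`I_p` acts on `C` by the `p`-cyclotomic character. That is, `C ≅ μ_{p^∞}` as an `I_p`-module … since
we are assuming that `p` is odd, the subgroup `C[p]` of `A[p]` is determined by the action of `I_p`:
`C[p] = μ_p` and `D[p]` is the maximal quotient of `A[p]` on which `I_p` acts trivially." The
intrinsic transfer of gens 8–9 (`GreenbergVatsalTorsionLine.natCard_gvSelmer_inf_torsion_mul_eq_of_inertia`,
`GreenbergVatsalTorsionInvariants.natCard_gvSelmer_inf_torsion_eq_of_inertia`) encodes this as the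
per-module hypothesis `hgen`: "every `c ∈ C[p]` is `τ•c' − c'` for some `τ ∈ I_v`, `c' ∈ C[p]`".
THIS FILE PROVES `hgen` for Greenberg's own datum `reductionData` (`GreenbergVatsalReductionDatum`)
of a globally minimal `E/ℚ` at an ODD prime `p ∤ Δ_E` of ORDINARY reduction (`p ∤ a_p`):
* `exists_generator_and_inertia_smul_eq_two` — a generator `P₁` of the line
  `ker red_v ∩ E(K̄_v)[p]` (the tree's ordinary filtration `localRed_ordinary_filtration`, Greenberg
  LNM 1716 p. 62) and `σ₀` in the local inertia group with `σ₀P₁ = 2P₁`: inertia acts on the line by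
  scalars `c(σ)` and trivially on `E(K̄_v)[p]/ℤP₁` (`localRed_smul_of_mem_absInertia`), so the WEIL
  PAIRING (tree theorem `localPoints_exists_isPrimitiveRoot_smul_eq_pow`, Silverman III.8.1 —
  `det ρ̄ = χ̄`) yields a primitive `p`-th root of unity `ζ` with `σζ = ζ^{c(σ)}` on inertia
  (`C[p] ≅ μ_p`), and `χ_p(I_{ℚ_v}) = ℤ_p^×` (tree theorem
  `adicCompletion_rat_exists_mem_absInertia_cyclotomicCharacter_eq`, local Kronecker–Weber /
  Serre *Local Fields* IV §4 Prop. 17) supplies `σ₀` with `χ_p(σ₀) = 2`, whence `c(σ₀) ≡ 2 (mod p)`;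
* **`reductionData_hgen`** — `hgen` for `reductionData W p hΔ`: take `τ = res σ₀`, `c' = c`.
With `GreenbergVatsalReductionDatum` (`htriv`, Kummer) and `GreenbergVatsalTorsionCurve` (`hM`,
`hdiv`, `hunr`, finiteness of `E(ℚ_∞)[p^∞]`) EVERY hypothesis of the intrinsic transfer is now a
tree theorem for the good-ordinary member of a route-G pair at an odd prime (see
`GreenbergVatsalTransferCurve` for the assembled statement).

References: Greenberg–Vatsal 2000, §2 p. 26; Silverman, *AEC* 2nd ed., III.8.1, VII.2.1; Serre,
*Local Fields*, IV §4 Prop. 17; Greenberg, LNM 1716, §1 p. 62.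
-/

noncomputable section

open scoped Classical AddSubgroup NNReal

open NumberField IsDedekindDomain Field
open Literature.NumberTheory.EllipticCurves Literature.NumberTheory.EllipticCurves.GreenbergSelmer
  Literature.NumberTheory.GaloisRepresentations IsDedekindDomain.HeightOneSpectrum
  Summit.BirchSwinnertonDyer.Rank1Residual.X2.GreenbergVatsalTorsion
  Summit.BirchSwinnertonDyer.Rank1Residual.X2.GreenbergVatsalReductionDatum
open WeierstrassCurve (minimalDiscriminantInt integralModelInt)

universe u

namespace Summit.BirchSwinnertonDyer.Rank1Residual.X2.GreenbergVatsalReductionDatumLine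

variable (W : WeierstrassCurve ℚ) [W.IsGloballyMinimal] [W.IsElliptic] (p : ℕ) [hp : Fact p.Prime]
  {v : HeightOneSpectrum (𝓞 ℚ)}

/-- **The ordinary line `C[p] = ker(E[p] → Ẽ)` of `E(K̄_v)` and the scalar `2` on it.** For a
globally minimal `E/ℚ`, an ODD prime `p ∤ Δ_E` with `p ∤ a_p` (good ordinary) and the place `v ∋ p`:
there are a point `P₁ ∈ E(K̄_v)` of order `p` with `red_v P₁ = 0` generating
`ker red_v ∩ E(K̄_v)[p]`, and an element `σ₀` of the local INERTIA group with `σ₀ P₁ = 2 P₁`.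
Proof: the ordinary filtration (`localRed_ordinary_filtration`: `ker red_v ∩ E[p]` is cyclic of
order `p`), inertia acts on it by scalars `c(σ)` and trivially on `E(K̄_v)[p]/ℤP₁`
(`localRed_smul_of_mem_absInertia`), so by the WEIL PAIRING (`localPoints_exists_isPrimitiveRoot_smul_eq_pow`,
Silverman III.8.1: `det ρ̄ = χ̄`) there is a primitive `p`-th root of unity `ζ` with `σζ = ζ^{c(σ)}`
on inertia — i.e. `C[p] ≅ μ_p` as an `I_p`-module (GV p. 26: "By the Weil pairing, one sees that the
inertia group `I_p` acts on `C` by the `p`-cyclotomic character … `C[p] = μ_p`"); and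
`χ_p(I_{ℚ_v}) = ℤ_p^×` (`adicCompletion_rat_exists_mem_absInertia_cyclotomicCharacter_eq`, local
Kronecker–Weber) provides `σ₀ ∈ I_{ℚ_v}` with `χ_p(σ₀) = 2`.
[cite: GreenbergVatsal2000, §2 p. 26] [cite: SilvermanAEC2009, Prop. III.8.1] -/
theorem exists_generator_and_inertia_smul_eq_two (hp2 : p ≠ 2) (hpv : ((p : ℕ) : 𝓞 ℚ) ∈ v.asIdeal)
    (hΔ : ¬ (p : ℤ) ∣ minimalDiscriminantInt W) (hord : ¬ (p : ℤ) ∣ W.frobeniusTrace p) :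
    ∃ (P₁ : localPoints W (v.adicCompletion ℚ)) (σ₀ : absoluteGaloisGroup (v.adicCompletion ℚ)),
      localRed W p hpv hΔ P₁ = 0 ∧ addOrderOf P₁ = p ∧
      (∀ P : localPoints W (v.adicCompletion ℚ), localRed W p hpv hΔ P = 0 → (p : ℤ) • P = 0 →
        ∃ j : ℕ, P = j • P₁) ∧
      σ₀ ∈ absInertia (v.adicCompletion ℚ) ∧ σ₀ • P₁ = (2 : ℕ) • P₁ := by
  -- NB: no `CharZero (ℚ_v)` instance is put in scope (it would switch the `ℚ`-algebra structure of
  -- `ℚ_v` to `DivisionRing.toRatAlgebra` and break the identification of `localPoints`).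
  haveI : NeZero ((p : ℕ) : v.adicCompletion ℚ) := ⟨by
    rw [← map_natCast (algebraMap ℚ (v.adicCompletion ℚ))]
    exact (map_ne_zero_iff _ (algebraMap ℚ (v.adicCompletion ℚ)).injective).mpr
      (Nat.cast_ne_zero.mpr hp.out.ne_zero)⟩
  have hpp : 2 < p := lt_of_le_of_ne hp.out.two_le (Ne.symm hp2)
  set red := localRed W p hpv hΔ with hred
  have hΔu := W.isUnit_Δ_localIntModel hpv (specVal_spec v) hΔ
  have hvO : (specVal v).Integers (specVal v).valuationSubring :=
    Valuation.valuationSubring.integers (specVal v)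
  -- residue characteristic `p`
  have hpO : specVal v ((p : ℕ) : AlgebraicClosure (v.adicCompletion ℚ)) < 1 := by
    have h := spectralValuation_algebraMap_ringOfIntegers_lt_one (v := v) (specVal_spec v) hpv
    rwa [map_natCast] at h
  haveI hchar : CharP (IsLocalRing.ResidueField ↥(specVal v).valuationSubring) p := by
    refine (CharP.charP_iff_prime_eq_zero hp.out).mpr ?_
    rw [← map_natCast (IsLocalRing.residue ↥(specVal v).valuationSubring),
      IsLocalRing.residue_eq_zero_iff, IsLocalRing.mem_maximalIdeal, mem_nonunits_iff,
      hvO.isUnit_iff_valuation_eq_one]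
    exact fun h ↦ absurd h (ne_of_lt (by simpa using hpO))
  -- the ordinary filtration at level `p`
  have hordA := W.exists_zsmul_eq_zero_localRed_ne_zero (specVal_spec v) hΔu red (fun _ ↦ rfl)
    hpv hΔ hord
  obtain ⟨hgenr, -, -⟩ := W.localRed_ordinary_filtration hΔu red (fun _ ↦ rfl) hordA
  obtain ⟨P₁, hP₁red, hP₁ord, hP₁gen⟩ := hgenr 1
  rw [pow_one] at hP₁ord
  have hP₁gen' : ∀ P : localPoints W (v.adicCompletion ℚ), red P = 0 → (p : ℤ) • P = 0 →
      ∃ j : ℕ, P = j • P₁ := fun P hP hpP ↦ hP₁gen P hP (by rw [pow_one]; exact hpP)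
  -- inertia acts by scalars on `P₁` and trivially on `E(K̄_v)[p] / ℤ P₁`
  have hsc : ∀ σ : absoluteGaloisGroup (v.adicCompletion ℚ), ∃ cσ : ℕ,
      σ ∈ absInertia (v.adicCompletion ℚ) → σ • P₁ = cσ • P₁ := by
    intro σ
    by_cases hσ : σ ∈ absInertia (v.adicCompletion ℚ)
    · have hσp : (p : ℤ) • (σ • P₁) = σ • ((p : ℤ) • P₁) :=
        (map_zsmul (DistribSMul.toAddMonoidHom (localPoints W (v.adicCompletion ℚ)) σ)
          (p : ℤ) P₁).symm
      obtain ⟨cσ, h⟩ := hP₁gen' (σ • P₁)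
        (by rw [hred, localRed_smul_of_mem_absInertia W p hpv hΔ hσ, ← hred, hP₁red])
        (by rw [hσp, ← hP₁ord, natCast_zsmul, addOrderOf_nsmul_eq_zero, smul_zero])
      exact ⟨cσ, fun _ ↦ h⟩
    · exact ⟨0, fun h ↦ absurd h hσ⟩
  choose c hc using hsc
  have h2 : ∀ σ ∈ (absInertia (v.adicCompletion ℚ) : Set (absoluteGaloisGroup (v.adicCompletion ℚ))),
      ∀ Q : localPoints W (v.adicCompletion ℚ), ((p ^ 1 : ℕ) : ℤ) • Q = 0 →
        ∃ d : ℕ, σ • Q - (fun _ ↦ (1 : ℕ)) σ • Q = d • P₁ := by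
    intro σ hσ Q hQ
    rw [pow_one] at hQ
    have hσQ : (p : ℤ) • (σ • Q) = σ • ((p : ℤ) • Q) :=
      (map_zsmul (DistribSMul.toAddMonoidHom (localPoints W (v.adicCompletion ℚ)) σ)
        (p : ℤ) Q).symm
    obtain ⟨d, hd⟩ := hP₁gen' (σ • Q - Q)
      (by rw [map_sub, hred, localRed_smul_of_mem_absInertia W p hpv hΔ hσ, sub_self])
      (by rw [smul_sub, hσQ, hQ, smul_zero, sub_zero])
    exact ⟨d, by rw [one_smul]; exact hd⟩
  -- the Weil pairing: a primitive `p`-th root of unity on which inertia acts by the same scalars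
  obtain ⟨ζ, hζ, hζσ⟩ := @WeierstrassCurve.localPoints_exists_isPrimitiveRoot_smul_eq_pow ℚ _ W _
    (v.adicCompletion ℚ) _ _
    (charZero_of_injective_algebraMap (algebraMap ℚ (v.adicCompletion ℚ)).injective) p _ 1 P₁
    (by rw [pow_one]; exact hP₁ord)
    (absInertia (v.adicCompletion ℚ) : Set (absoluteGaloisGroup (v.adicCompletion ℚ)))
    c (fun _ ↦ 1) (fun σ hσ ↦ hc σ hσ) h2
  rw [pow_one] at hζ
  -- `χ_p(σ₀) = 2` for some `σ₀` in the local inertia group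
  have h2unit : IsUnit ((2 : ℕ) : ℤ_[p]) := by
    rw [PadicInt.isUnit_iff]
    refine le_antisymm (PadicInt.norm_le_one _) (not_lt.mp fun hlt ↦ ?_)
    have hlt' : ‖(((2 : ℕ) : ℤ) : ℤ_[p])‖ < 1 := by exact_mod_cast hlt
    have hdvd : (p : ℤ) ∣ ((2 : ℕ) : ℤ) := (PadicInt.norm_int_lt_one_iff_dvd _).mp hlt'
    have hdvd' : p ∣ 2 := by exact_mod_cast hdvd
    exact hp2 ((Nat.prime_dvd_prime_iff_eq hp.out Nat.prime_two).mp hdvd')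
  have hvp : (Rat.HeightOneSpectrum.primesEquiv v : ℕ) = p :=
    Rat.HeightOneSpectrum.primesEquiv_eq_of_natCast_mem v hp.out hpv
  obtain ⟨σ₀, hσ₀I, hχ⟩ :=
    adicCompletion_rat_exists_mem_absInertia_cyclotomicCharacter_eq p v hvp h2unit.unit
  have hζp : ζ ^ p ^ 1 = 1 := by rw [pow_one]; exact hζ.pow_eq_one
  have hσ₀ζ : σ₀ • ζ = ζ ^ 2 := by
    rw [GaloisRep.cyclotomicCharacter_spec (v.adicCompletion ℚ) p σ₀ ζ hζp, hχ, IsUnit.unit_spec,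
      map_natCast, ZMod.val_natCast, pow_one, Nat.mod_eq_of_lt hpp]
  -- compare exponents: `c σ₀ ≡ 2 (mod p)`
  have hcmp : ζ ^ (c σ₀ % p) = ζ ^ 2 := by
    rw [← hσ₀ζ, hζσ σ₀ hσ₀I, one_mul, hζ.eq_orderOf, pow_mod_orderOf]
  have hmod : c σ₀ % p = 2 :=
    hζ.pow_inj (Nat.mod_lt _ hp.out.pos) hpp hcmp
  refine ⟨P₁, σ₀, hP₁red, hP₁ord, hP₁gen', hσ₀I, ?_⟩
  rw [hc σ₀ hσ₀I, ← hmod, ← hP₁ord, mod_addOrderOf_nsmul]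

/-- **`hgen` for Greenberg's datum: the inertia group MOVES every point of `C[p]`** — for every
`c ∈ C_v ∩ E[p^∞][p]` there are `τ ∈ I_v` and `c' ∈ C_v ∩ E[p^∞][p]` with `τ•c' − c' = c` (take
`τ = res σ₀` with `χ_p(σ₀) = 2` and `c' = c`: `σ₀` acts on the line `C[p] ≅ μ_p` as `2`). This is
the hypothesis `hgen` of `GreenbergVatsalTorsionLine.natCard_gvSelmer_inf_torsion_mul_eq_of_inertia`
/ `GreenbergVatsalTorsionInvariants.natCard_gvSelmer_inf_torsion_eq_of_inertia`, DISCHARGED for the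
good-ordinary member of a route-G pair at an odd prime (GV p. 26: "since we are assuming that `p` is
odd, the subgroup `C[p]` of `A[p]` is determined by the action of `I_p`: `C[p] = μ_p`").
[cite: GreenbergVatsal2000, §2 p. 26] [cite: SilvermanAEC2009, Prop. III.8.1] -/
theorem reductionData_hgen (hp2 : p ≠ 2) (hΔ : ¬ (p : ℤ) ∣ minimalDiscriminantInt W)
    (hord : ¬ (p : ℤ) ∣ W.frobeniusTrace p) :
    ∀ (v : HeightOneSpectrum (𝓞 ℚ)) (hv : ((p : ℕ) : 𝓞 ℚ) ∈ v.asIdeal),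
      ∀ c ∈ (torsionData (reductionData W p hΔ) p v hv).plus, ∃ τ ∈ inertia v,
        ∃ c' ∈ (torsionData (reductionData W p hΔ) p v hv).plus, τ • c' - c' = c := by
  intro v hv c hc
  obtain ⟨P₁, σ₀, -, -, hP₁gen, hσ₀I, hσ₀P₁⟩ :=
    exists_generator_and_inertia_smul_eq_two W p hp2 hv hΔ hord
  refine ⟨absGaloisRestrict ℚ (v.adicCompletion ℚ) σ₀, Subgroup.mem_map_of_mem _ hσ₀I, c, hc, ?_⟩
  -- `ι c = j • P₁`
  have hcC : localRed W p hv hΔ (pointsMap W (v.adicCompletion ℚ)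
      (((c : (W.geomPrimaryTorsion p)) : W.geomPoints))) = 0 := hc
  have hcp : (p : ℤ) • pointsMap W (v.adicCompletion ℚ) ((c : W.geomPrimaryTorsion p) : W.geomPoints)
      = 0 := by
    have h : p • (c : (W.geomPrimaryTorsion p)[(p : ℤ)]) = 0 := AddSubgroup.torsionBy.nsmul c
    have h' := congrArg (fun z : (W.geomPrimaryTorsion p)[(p : ℤ)] ↦
      pointsMap W (v.adicCompletion ℚ) ((z : W.geomPrimaryTorsion p) : W.geomPoints)) h
    simp only [AddSubgroupClass.coe_nsmul, map_nsmul, ZeroMemClass.coe_zero, map_zero] at h'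
    rw [natCast_zsmul]; exact h'
  obtain ⟨j, hj⟩ := hP₁gen _ hcC hcp
  -- compare in `E(K̄_v)` via the injection `ι`
  apply Subtype.ext
  apply Subtype.ext
  apply pointsMapOfEmb_injective W (closureEmb (K := ℚ) (v.adicCompletion ℚ))
  change pointsMap W (v.adicCompletion ℚ)
      (((absGaloisRestrict ℚ (v.adicCompletion ℚ) σ₀ • c - c : (W.geomPrimaryTorsion p)[(p : ℤ)]) :
        W.geomPrimaryTorsion p) : W.geomPoints) =
    pointsMap W (v.adicCompletion ℚ) ((c : W.geomPrimaryTorsion p) : W.geomPoints)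
  rw [AddSubgroupClass.coe_sub, AddSubgroupClass.coe_sub, map_sub]
  change pointsMap W (v.adicCompletion ℚ)
      (absGaloisRestrict ℚ (v.adicCompletion ℚ) σ₀ • ((c : W.geomPrimaryTorsion p) : W.geomPoints)) -
    pointsMap W (v.adicCompletion ℚ) ((c : W.geomPrimaryTorsion p) : W.geomPoints) = _
  rw [pointsMap_absGaloisRestrict_smul, hj]
  have hσj : σ₀ • (j • P₁) = j • (σ₀ • P₁) :=
    map_nsmul (DistribSMul.toAddMonoidHom (localPoints W (v.adicCompletion ℚ)) σ₀) j P₁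
  rw [hσj, hσ₀P₁, two_nsmul, nsmul_add, add_sub_cancel_right]

end Summit.BirchSwinnertonDyer.Rank1Residual.X2.GreenbergVatsalReductionDatumLine

end
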